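import Summits.ABC.IUTFork.Repair.RHSigmaMassMuDatum
import Summits.ABC.IUTFork.Repair.RHCellWeightsCreditScreen
import HarnessLib

/-!
# R-H ROUND 2/3, «Q1′ = Q3» IN KERNEL: `μ(T) = 1` ⟺ the datum's slice is EVERYTHING at every bad packet; with a tolerance, no-loss [MU-C] FORCES
# full licence at every packet heavier than `l⋇·Tol/(l⋇² − 1)`; the shortfall `M − mass(Σ_data) = (1/l⋇)·Σᶠ_{v_ℚ} (S(l⋇) − S(j₀(v_ℚ)))·h(v_ℚ)` exactly

abc-iut cell, rung LADDER-ABC:A2.RESCUE.H; R-H seat abc-iut-rh2-w-1 (GEN 2; Q1′ WEIGHTS typer, kernel side); sequel of `Repair/RHSigmaMassMu{,Datum}.lean` (p482743 /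
p483646). PROOF-ONLY (0 definitions, 0 `Prop` facts). `plan/rescue/R-H/MIN-SLICE.md` §(iv) TWO-SCALE STATEMENT (c) «Q1′ = Q3 for the initial-segment rows — UPHELD:
the minimum slice that still implies abc with print's constants, intersected with what a genuine datum supplies, is the WHOLE datum» and §(v-2) READING «`μ → 1`
⟺ exponent `→ 1 + ε` ⟺ `Σ_data ∩ place →` all labels at (`h_v`-almost) every bad place». This file types both sentences for a LABEL-SEGMENT stratum `σ` (every kept
row's `Σ_data`, `plan/rescue/R-H/SLICE.md`; boundaries `j₀(v_ℚ) ≤ l⋇`) at the genuine bed, BY NAME over the companions and abc-iut-rh2-T-1's `RH.SigmaMass`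
(`mem_of_offTrivialMass_le_of_lt_cost`, p477034), nothing restated:
* §0 `S` is STRICTLY monotone from `1` on: `m < n`, `1 ≤ m` ⟹ `S(m) < S(n)` (`sqSubOneSum_lt_of_lt`); `S(m) = S(n)`, `m ≤ n`, `2 ≤ n` ⟹ `m = n` (`eq_of_sqSubOneSum_eq`).
* §1 AT THE BED (any DH pilot datum `X`, realising ideles; explicit place weight `h`): **THE SHORTFALL EXACTLY** `M − mass(σ) = (Σᶠ_{v_ℚ} (S(l⋇) − S(j₀(v_ℚ)))·h(v_ℚ))/l⋇`
  (`totalTrivialMass_sub_onTrivialMass_settingPrVolSharp_labelSegment_eq`; = `B_triv(σᶜ)`); **`mass(σ) = M ⟺ ∀ v_ℚ, h(v_ℚ) ≠ 0 → j₀(v_ℚ) = l⋇`**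
  (`onTrivialMass_eq_totalTrivialMass_iff_forall_top_settingPrVolSharp` — `μ = 1` iff the WHOLE datum is in `Σ` at every bad packet); **WITH A TOLERANCE**:
  `B_triv(σᶜ) ≤ tol ⟹ ∀ v_ℚ, l⋇·tol < (l⋇² − 1)·h(v_ℚ) → j₀(v_ℚ) = l⋇` (`forall_top_of_offTrivialMass_le_settingPrVolSharp_labelSegment` — the top cell of a heavy
  packet costs more than the whole tolerance, rh2-T-1's no-interior lemma, and a segment containing its top label is everything): «Q1′ = Q3 up to the sliver».
* §2 AT THE DATUM (chosen ideles, `M = T.gap`): `μ(T) = 1 ⟺ ∀ bad packets j₀ = l⋇` (`onTrivialMass_eq_gap_iff_forall_top_chosen`) and the no-loss [MU-C]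
  `OffSigmaTolerance (1 − 1) A T (B_triv(σᶜ))` (rh2-T-1's `μ₀ = 1` regression, = [THR]) ⟹ `j₀(v_ℚ) = l⋇` at every packet with `(l⋇² − 1)·h(v_ℚ) > l⋇·A`
  (`forall_top_of_offSigmaTolerance_one_chosen`) — with `A = Tol(P,l)`: every packet of place weight `h_p > l⋇·Tol/(l⋇²−1) ≈ 2·Tol/l` must be licensed to the
  TOP label, i.e. `l ≥ l₀(datum)` of Q3 for all but the sliver of light packets.
HONEST FRAMING: identities/inequalities about OUR typed quantities at the genuine bed; [MU-C]/[THR] are HYPOTHESIS SHAPES; nothing here asserts that abc is proved or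
refuted, or that [IUTchIII] Cor. 3.12 holds or fails at any datum, or takes a side on any author; typed ≠ proved; computed ≠ proved. [claim: Mochizuki2012, status: disputed]
for every IUT locution. [cite: Mochizuki2012, IUTchIII Cor. 3.12 p. 173–174, Prop. 3.9 (i)–(iii) p. 116–117; IUTchIV Thm. 1.10 p. 23, Step (v) p. 27–29,
Steps (viii)–(x) p. 30–32] [cite: DupuyHilado2025, §3.3, Thm. 3.10.1]
-/

noncomputable section

open Set Function NumberField IsDedekindDomain

namespace Summit.ABC.IUTFork.Repair.RH.CellWeights

open Summit.ABC.IUTFork.Thm311 Summit.ABC.IUTFork.Thm311.Real Summit.ABC.IUTFork.Cor312 Summit.ABC.IUTFork.Cor312.Setting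
  Summit.ABC.IUTFork.Cor312Vol Summit.ABC.IUTFork.Cor312Prov Literature.IUT.LogThetaLattice Literature.IUT.LogVolume
  Literature.IUT.HodgeTheaters Literature.IUT.LogVolume.ThetaData Literature.NumberTheory.DiophantineGeometry.GenEll
  Summit.ABC.IUTFork.Repair.RH.SigmaLicence Summit.ABC.IUTFork.Repair.RH.SigmaStrataEq Summit.ABC.IUTFork.Repair.RH.SigmaMass
  Summit.ABC.IUTFork.Repair.RH.OffSigma Summit.ABC.IUTFork.Conditional

/-! ## §0. `S(k) = k(k−1)(2k+5)/6` is strictly monotone from `1` on -/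

section LabelArithmetic

/-- `S(m) < S(n)` for `1 ≤ m < n` (`S(k+1) − S(k) = (k+1)² − 1 > 0` for `k ≥ 1`; `S(0) = S(1) = 0`). [folklore] -/
theorem sqSubOneSum_lt_of_lt {m n : ℕ} (hm : 1 ≤ m) (hmn : m < n) :
    (m : ℝ) * (m - 1) * (2 * m + 5) / 6 < (n : ℝ) * (n - 1) * (2 * n + 5) / 6 := by
  have h1 : (m : ℝ) * (m - 1) * (2 * m + 5) / 6 < ((m + 1 : ℕ) : ℝ) * ((m + 1 : ℕ) - 1) * (2 * (m + 1 : ℕ) + 5) / 6 := by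
    have hm1 : (1 : ℝ) ≤ m := by exact_mod_cast hm
    push_cast
    nlinarith
  exact h1.trans_le (sqSubOneSum_mono (by omega))

/-- `S(m) = S(n)` with `m ≤ n` and `2 ≤ n` forces `m = n` (for `m ≤ 1`: `S(m) = 0 < 3 ≤ S(n)`). [folklore] -/
theorem eq_of_sqSubOneSum_eq {m n : ℕ} (hmn : m ≤ n) (hn : 2 ≤ n)
    (h : (m : ℝ) * (m - 1) * (2 * m + 5) / 6 = (n : ℝ) * (n - 1) * (2 * n + 5) / 6) : m = n := by
  by_contra hne
  have hlt : m < n := lt_of_le_of_ne hmn hne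
  rcases Nat.lt_or_ge m 1 with hm0 | hm1
  · have hm : m = 0 := by omega
    subst hm
    have hpos := sqSubOneSum_pos hn
    norm_num at h
    linarith
  · exact absurd h (sqSubOneSum_lt_of_lt hm1 hlt).ne

end LabelArithmetic

/-! ## §1. At the bed: the shortfall of a label-segment stratum exactly, `μ = 1` iff full licence at every bad packet, the tolerance form -/

section Bed

variable {F : Type} [Field F] [NumberField F] (X : PilotData F) {logv : PadicLogs F} (hlog : LogvAnalytic logv)
  (M : Type) [Field M] [NumberField M]
  (archPk : ∀ (j : (thetaIndex X).Label) (vQ : (thetaIndex X).VQ), Set ((logShellsDH X logv).Packet j vQ))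
  (archSub : ∀ (j : (thetaIndex X).Label) (v : (thetaIndex X).V),
    Set ((logShellsDH X logv).Packet j ((thetaIndex X).over v)))
  (Ψ : ℤ → ∀ v : (thetaIndex X).V, v ∈ (thetaIndex X).Vbad → Set ((logShellsDH X logv).StarPacket v))
  (act : ℤ → ∀ v : (thetaIndex X).V, v ∈ (thetaIndex X).Vbad →
    (logShellsDH X logv).StarPacket v → Module.End ℚ ((logShellsDH X logv).StarPacket v))
  (Mmod : ℤ → ∀ j : (thetaIndex X).LabelStar, Set ((logShellsDH X logv).GlobalPacket j.1))
  (region : ℤ → ∀ j : (thetaIndex X).LabelStar, FinDivisor M → ∀ vQ : (thetaIndex X).VQ,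
    Set ((logShellsDH X logv).Packet j.1 vQ))
  (n : ℤ) {HT : Type} {LogLink : HT → HT → Type} {IsFull : ∀ {s t : HT}, LogLink s t → Prop}
  (lat : LGPGaussianLogThetaLattice LogLink IsFull)
  {Frd : Type} {IsoF : Frd → Frd → Type} {Ob : Frd → Type} {realify : Frd → Frd} {Strip : Type}
  {IsoS : Strip → Strip → Type} {Mv : ∀ v : (thetaIndex X).V, v ∈ (thetaIndex X).Vbad → Type}
  [∀ v h, Monoid (Mv v h)]
  (sig : GlobalLGPFrobenioidSignature (thetaIndex X).lstar (thetaIndex X).V (· ∈ (thetaIndex X).Vbad)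
    Frd IsoF Ob realify Strip IsoS Mv)
  (split : SplittingMonoids Mv) {ObΔ : Type} {N : ∀ v : (thetaIndex X).V, v ∈ (thetaIndex X).Vbad → Type}
  [∀ v h, Monoid (N v h)] (qData : QPilotData ObΔ N)
  (tq : ∀ (pp : Nat.Primes) (x : (thetaIndex X).Fibre (.inr pp)), haveI : Fact (pp : ℕ).Prime := ⟨pp.2⟩; kOf X pp.1 x)
  (t : ∀ (pp : Nat.Primes) (_ : Fin X.lstar) (x : (thetaIndex X).Fibre (.inr pp)),
    haveI : Fact (pp : ℕ).Prime := ⟨pp.2⟩; kOf X pp.1 x)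
  (htq0 : ∀ pp x, tq pp x ≠ 0)
  (htq1 : ∀ (pp : Nat.Primes) (x : (thetaIndex X).Fibre (.inr pp)),
    haveI : Fact (pp : ℕ).Prime := ⟨pp.2⟩; placeOf X pp.1 x ∉ X.S → ‖tq pp x‖ = 1)
  (ht0 : ∀ pp i x, t pp i x ≠ 0)
  (ht1 : ∀ (pp : Nat.Primes) (i : Fin X.lstar) (x : (thetaIndex X).Fibre (.inr pp)),
    haveI : Fact (pp : ℕ).Prime := ⟨pp.2⟩; placeOf X pp.1 x ∉ X.S → ‖t pp i x‖ = 1)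
  (ht : ∀ (pp : Nat.Primes) (i : Fin X.lstar) (x : (thetaIndex X).Fibre (.inr pp)),
    haveI : Fact (pp : ℕ).Prime := ⟨pp.2⟩
    Real.log ‖t pp i x‖ = -(X.thetaPilot i (placeOf X pp.1 x)) * logNorm F (placeOf X pp.1 x) / localDegree F (placeOf X pp.1 x))
  (htq : ∀ (pp : Nat.Primes) (x : (thetaIndex X).Fibre (.inr pp)),
    haveI : Fact (pp : ℕ).Prime := ⟨pp.2⟩
    Real.log ‖tq pp x‖ = -(X.qPilot (placeOf X pp.1 x)) * logNorm F (placeOf X pp.1 x) / localDegree F (placeOf X pp.1 x))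

include ht0 ht htq in
/-- **THE SHORTFALL OF A LABEL-SEGMENT STRATUM, EXACTLY**: at the bed (realising ideles), for `σ` meeting every packet in the labels `j = i+1 ≤ j₀(v_ℚ)` (`j₀ ≤ l⋇`),
`M − mass(σ) = (Σᶠ_{v_ℚ} (S(l⋇) − S(j₀(v_ℚ)))·h(v_ℚ))/l⋇` (= `B_triv(σᶜ)` by rh2-T-1's `onTrivialMass_add_offTrivialMass`) — the top blocks `(j₀(v_ℚ), l⋇]` of the
bad packets, weighted by `h`. [claim: Mochizuki2012, status: disputed] -/
theorem totalTrivialMass_sub_onTrivialMass_settingPrVolSharp_labelSegment_eq {j₀ : (thetaIndex X).VQ → ℕ} (hj : ∀ vQ, j₀ vQ ≤ X.lstar)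
    (σ : Set (Fin (thetaIndex X).lstar × (thetaIndex X).VQ))
    (hσ : ∀ (i : Fin (thetaIndex X).lstar) (vQ : (thetaIndex X).VQ), (i, vQ) ∈ σ ↔ (i : ℕ) + 1 ≤ j₀ vQ) :
    totalTrivialMass (settingPrVolSharp X hlog M archPk archSub Ψ act Mmod region n lat sig split qData tq t htq0 htq1) -
        onTrivialMass (settingPrVolSharp X hlog M archPk archSub Ψ act Mmod region n lat sig split qData tq t htq0 htq1) σ =
      (∑ᶠ vQ : (thetaIndex X).VQ, ((X.lstar : ℝ) * (X.lstar - 1) * (2 * X.lstar + 5) / 6 - (j₀ vQ : ℝ) * (j₀ vQ - 1) * (2 * j₀ vQ + 5) / 6) *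
        Sum.elim (fun _ : Unit => (0 : ℝ))
          (fun pp : Nat.Primes => (∑ v ∈ placesOver F pp, X.qPilot v * logNorm F v) / Module.finrank ℚ F) vQ) / X.lstar := by
  have hhfin := placeWeight_support_finite X hlog M archPk archSub Ψ act Mmod region n lat sig split qData tq t htq0 htq1 htq
  rw [totalTrivialMass_settingPrVolSharp_eq_sqSubOneSum_mul_finsum_placeWeight X hlog M archPk archSub Ψ act Mmod region n lat sig split qData tq t htq0 htq1
      ht0 ht htq,
    onTrivialMass_settingPrVolSharp_labelSegment_eq X hlog M archPk archSub Ψ act Mmod region n lat sig split qData tq t htq0 htq1 ht0 ht htq hj σ hσ,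
    mul_finsum, ← sub_div]
  congr 1
  rw [← finsum_sub_distrib (hhfin.subset (Function.support_subset_iff'.2 fun vQ hvQ => by rw [Function.notMem_support.1 hvQ, mul_zero]))
    (hhfin.subset (Function.support_subset_iff'.2 fun vQ hvQ => by rw [Function.notMem_support.1 hvQ, mul_zero]))]
  exact finsum_congr fun vQ => by ring

include ht0 ht htq in
/-- **`μ = 1` ⟺ THE WHOLE DATUM IS IN `Σ` AT EVERY BAD PACKET**: at the bed, for a label-segment stratum `σ` (`j₀ ≤ l⋇`), `mass(σ) = M` ⟺ `j₀(v_ℚ) = l⋇` at every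
packet of non-zero place weight (the shortfall is a finite sum of the non-negative terms `(S(l⋇) − S(j₀))·h`; `S` is strictly monotone from `1` on and `S(l⋇) ≥ 3`).
MIN-SLICE §(v-2): «`μ → 1` ⟺ `Σ_data ∩ place →` all labels at every bad place» — here the exact `μ = 1` case. [claim: Mochizuki2012, status: disputed] -/
theorem onTrivialMass_eq_totalTrivialMass_iff_forall_top_settingPrVolSharp {j₀ : (thetaIndex X).VQ → ℕ} (hj : ∀ vQ, j₀ vQ ≤ X.lstar)
    (σ : Set (Fin (thetaIndex X).lstar × (thetaIndex X).VQ))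
    (hσ : ∀ (i : Fin (thetaIndex X).lstar) (vQ : (thetaIndex X).VQ), (i, vQ) ∈ σ ↔ (i : ℕ) + 1 ≤ j₀ vQ) :
    onTrivialMass (settingPrVolSharp X hlog M archPk archSub Ψ act Mmod region n lat sig split qData tq t htq0 htq1) σ =
        totalTrivialMass (settingPrVolSharp X hlog M archPk archSub Ψ act Mmod region n lat sig split qData tq t htq0 htq1) ↔
      ∀ vQ : (thetaIndex X).VQ, Sum.elim (fun _ : Unit => (0 : ℝ))
          (fun pp : Nat.Primes => (∑ v ∈ placesOver F pp, X.qPilot v * logNorm F v) / Module.finrank ℚ F) vQ ≠ 0 → j₀ vQ = X.lstar := by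
  have hhfin := placeWeight_support_finite X hlog M archPk archSub Ψ act Mmod region n lat sig split qData tq t htq0 htq1 htq
  have hdiff := totalTrivialMass_sub_onTrivialMass_settingPrVolSharp_labelSegment_eq X hlog M archPk archSub Ψ act Mmod region n lat sig split qData tq t
    htq0 htq1 ht0 ht htq hj σ hσ
  have hl0 : (0 : ℝ) < X.lstar := by exact_mod_cast lt_of_lt_of_le (by norm_num) X.two_le_lstar
  -- the summands of the shortfall
  have hterm0 : ∀ vQ : (thetaIndex X).VQ, 0 ≤ ((X.lstar : ℝ) * (X.lstar - 1) * (2 * X.lstar + 5) / 6 - (j₀ vQ : ℝ) * (j₀ vQ - 1) * (2 * j₀ vQ + 5) / 6) *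
      Sum.elim (fun _ : Unit => (0 : ℝ))
        (fun pp : Nat.Primes => (∑ v ∈ placesOver F pp, X.qPilot v * logNorm F v) / Module.finrank ℚ F) vQ :=
    fun vQ => mul_nonneg (sub_nonneg.2 (sqSubOneSum_mono (hj vQ))) (placeWeight_nonneg X vQ)
  have hsuppT : (Function.support fun vQ : (thetaIndex X).VQ =>
      ((X.lstar : ℝ) * (X.lstar - 1) * (2 * X.lstar + 5) / 6 - (j₀ vQ : ℝ) * (j₀ vQ - 1) * (2 * j₀ vQ + 5) / 6) *
        Sum.elim (fun _ : Unit => (0 : ℝ))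
          (fun pp : Nat.Primes => (∑ v ∈ placesOver F pp, X.qPilot v * logNorm F v) / Module.finrank ℚ F) vQ) ⊆ hhfin.toFinset :=
    fun vQ hv => by
      rw [Set.Finite.coe_toFinset]
      exact fun h0 => hv (by simp only [h0, mul_zero])
  constructor
  · intro heq vQ hne
    have hzero : (∑ᶠ vQ : (thetaIndex X).VQ, ((X.lstar : ℝ) * (X.lstar - 1) * (2 * X.lstar + 5) / 6 - (j₀ vQ : ℝ) * (j₀ vQ - 1) * (2 * j₀ vQ + 5) / 6) *
        Sum.elim (fun _ : Unit => (0 : ℝ))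
          (fun pp : Nat.Primes => (∑ v ∈ placesOver F pp, X.qPilot v * logNorm F v) / Module.finrank ℚ F) vQ) = 0 := by
      have h := hdiff
      rw [heq, sub_self] at h
      have h' := h.symm
      rw [div_eq_zero_iff] at h'
      exact h'.resolve_right hl0.ne'
    rw [finsum_eq_sum_of_support_subset _ hsuppT, Finset.sum_eq_zero_iff_of_nonneg fun vQ _ => hterm0 vQ] at hzero
    by_cases hmem : vQ ∈ hhfin.toFinset
    · have h1 := hzero vQ hmem
      rcases mul_eq_zero.mp h1 with h2 | h2
      · exact eq_of_sqSubOneSum_eq (hj vQ) X.two_le_lstar (sub_eq_zero.mp h2).symm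
      · exact absurd h2 hne
    · rw [Set.Finite.mem_toFinset, Function.mem_support, not_not] at hmem
      exact absurd hmem hne
  · intro htop
    have hzero : (∑ᶠ vQ : (thetaIndex X).VQ, ((X.lstar : ℝ) * (X.lstar - 1) * (2 * X.lstar + 5) / 6 - (j₀ vQ : ℝ) * (j₀ vQ - 1) * (2 * j₀ vQ + 5) / 6) *
        Sum.elim (fun _ : Unit => (0 : ℝ))
          (fun pp : Nat.Primes => (∑ v ∈ placesOver F pp, X.qPilot v * logNorm F v) / Module.finrank ℚ F) vQ) = 0 :=
      finsum_eq_zero_of_forall_eq_zero fun vQ => by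
        by_cases h0 : Sum.elim (fun _ : Unit => (0 : ℝ))
            (fun pp : Nat.Primes => (∑ v ∈ placesOver F pp, X.qPilot v * logNorm F v) / Module.finrank ℚ F) vQ = 0
        · rw [h0, mul_zero]
        · rw [htop vQ h0, sub_self, zero_mul]
    rw [hzero, zero_div, sub_eq_zero] at hdiff
    exact hdiff.symm

include ht0 ht1 ht htq in
/-- **WITH A TOLERANCE («Q1′ = Q3 up to the sliver»)**: at the bed, for a label-segment stratum `σ` (`j₀ ≤ l⋇`), `B_triv(σᶜ) ≤ tol` forces `j₀(v_ℚ) = l⋇` at EVERY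
packet with `(l⋇² − 1)·h(v_ℚ) > l⋇·tol` — the top cell `(l⋇, v_ℚ)` costs `(l⋇²−1)·h(v_ℚ) > l⋇·tol`, so it lies in `σ` (rh2-T-1 `mem_of_offTrivialMass_le_of_lt_cost`),
and a segment containing its top label is the whole packet. With `tol = Tol(P,l)`: every packet of weight `h > l⋇·Tol/(l⋇²−1) ≈ 2·Tol/l` is licensed to the top —
`l ≥ l₀(datum)` of Q3 off the sliver of light packets. [claim: Mochizuki2012, status: disputed] -/
theorem forall_top_of_offTrivialMass_le_settingPrVolSharp_labelSegment {j₀ : (thetaIndex X).VQ → ℕ} (hj : ∀ vQ, j₀ vQ ≤ X.lstar)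
    (σ : Set (Fin (thetaIndex X).lstar × (thetaIndex X).VQ))
    (hσ : ∀ (i : Fin (thetaIndex X).lstar) (vQ : (thetaIndex X).VQ), (i, vQ) ∈ σ ↔ (i : ℕ) + 1 ≤ j₀ vQ) {tol : ℝ}
    (htol : offTrivialMass (settingPrVolSharp X hlog M archPk archSub Ψ act Mmod region n lat sig split qData tq t htq0 htq1) σ ≤ tol)
    (vQ : (thetaIndex X).VQ)
    (hheavy : (X.lstar : ℝ) * tol < (((X.lstar : ℝ)) ^ 2 - 1) * Sum.elim (fun _ : Unit => (0 : ℝ))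
      (fun pp : Nat.Primes => (∑ v ∈ placesOver F pp, X.qPilot v * logNorm F v) / Module.finrank ℚ F) vQ) :
    j₀ vQ = X.lstar := by
  have H := bridgeHyps_settingPrVolSharp_of_ideles X hlog M archPk archSub Ψ act Mmod region n lat sig split qData t tq ht0 ht1 htq0 htq1
  have hl1 : 1 ≤ X.lstar := le_trans (by norm_num) X.two_le_lstar
  -- the top cell
  have htop : ((⟨X.lstar - 1, show X.lstar - 1 < X.lstar by omega⟩ : Fin (thetaIndex X).lstar), vQ) ∈ σ := by
    refine mem_of_offTrivialMass_le_of_lt_cost H htol ?_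
    rw [cellTrivialCost_settingPrVolSharp_eq_sqSubOne_mul_placeWeight X hlog M archPk archSub Ψ act Mmod region n lat sig split qData tq t htq0 htq1 ht0 ht htq]
    have hcast : (((X.lstar - 1 : ℕ) : ℝ) + 1) = (X.lstar : ℝ) := by
      rw [Nat.cast_sub hl1]
      push_cast
      ring
    dsimp only
    rw [hcast]
    exact hheavy
  have h := (hσ _ vQ).1 htop
  have h' : X.lstar ≤ j₀ vQ := by
    simp only at h
    omega
  exact le_antisymm (hj vQ) h'

end Bed

/-! ## §2. At a genuine Θ-volume datum with the chosen ideles: `μ(T) = 1` iff full licence; the no-loss [MU-C] forces full licence off the sliver -/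

section Datum

/-- **`μ(T) = 1` ⟺ THE WHOLE DATUM IS LICENSED AT EVERY BAD PACKET**: at the datum's bed with the chosen ideles, for a label-segment stratum `σ` with boundaries
`j₀(v_ℚ) ≤ l⋇`: `mass(σ) = T.gap` (`μ(T) = 1`) ⟺ `j₀(v_ℚ) = l⋇` at every packet of non-zero place weight — MIN-SLICE §(iv)/(v-2) «Q1′ = Q3» (exact case).
[claim: Mochizuki2012, status: disputed] -/
theorem onTrivialMass_eq_gap_iff_forall_top_chosen {P : NFPoint} {l : ℕ} (T : Cor22.ThetaVolumeDatumAt P l) :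
    letI := T.instFieldF; letI := T.instNumberFieldF; letI := T.instAlgebraF; letI := T.instFieldK; letI := T.instNumberFieldK; letI := T.instAlgebraK;
        letI := T.instFieldFbar; letI := T.instAlgebraFbar; letI := T.instAlgebraKFbar; letI := T.instIsElliptic;
    ∀ (M : Type) [Field M] [NumberField M]
      (archPk : ∀ (j : (thetaIndex (pilotDataOfK T.D T.K)).Label) (vQ : (thetaIndex (pilotDataOfK T.D T.K)).VQ), Set ((logShellsDH (pilotDataOfK T.D T.K) (analyticLogv T.K)).Packet j vQ))
      (archSub : ∀ (j : (thetaIndex (pilotDataOfK T.D T.K)).Label) (v : (thetaIndex (pilotDataOfK T.D T.K)).V),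
        Set ((logShellsDH (pilotDataOfK T.D T.K) (analyticLogv T.K)).Packet j ((thetaIndex (pilotDataOfK T.D T.K)).over v)))
      (Ψ : ℤ → ∀ v : (thetaIndex (pilotDataOfK T.D T.K)).V, v ∈ (thetaIndex (pilotDataOfK T.D T.K)).Vbad → Set ((logShellsDH (pilotDataOfK T.D T.K) (analyticLogv T.K)).StarPacket v))
      (act : ℤ → ∀ v : (thetaIndex (pilotDataOfK T.D T.K)).V, v ∈ (thetaIndex (pilotDataOfK T.D T.K)).Vbad →
        (logShellsDH (pilotDataOfK T.D T.K) (analyticLogv T.K)).StarPacket v → Module.End ℚ ((logShellsDH (pilotDataOfK T.D T.K) (analyticLogv T.K)).StarPacket v))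
      (Mmod : ℤ → ∀ j : (thetaIndex (pilotDataOfK T.D T.K)).LabelStar, Set ((logShellsDH (pilotDataOfK T.D T.K) (analyticLogv T.K)).GlobalPacket j.1))
      (region : ℤ → ∀ j : (thetaIndex (pilotDataOfK T.D T.K)).LabelStar, FinDivisor M →
        ∀ vQ : (thetaIndex (pilotDataOfK T.D T.K)).VQ, Set ((logShellsDH (pilotDataOfK T.D T.K) (analyticLogv T.K)).Packet j.1 vQ))
      (n : ℤ) {HT : Type} {LogLink : HT → HT → Type} {IsFull : ∀ {s t : HT}, LogLink s t → Prop} (lat : LGPGaussianLogThetaLattice LogLink IsFull)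
      {Frd : Type} {IsoF : Frd → Frd → Type} {Ob : Frd → Type} {realify : Frd → Frd} {Strip : Type} {IsoS : Strip → Strip → Type}
      {Mv : ∀ v : (thetaIndex (pilotDataOfK T.D T.K)).V, v ∈ (thetaIndex (pilotDataOfK T.D T.K)).Vbad → Type} [∀ v h, Monoid (Mv v h)]
      (sig : GlobalLGPFrobenioidSignature (thetaIndex (pilotDataOfK T.D T.K)).lstar (thetaIndex (pilotDataOfK T.D T.K)).V
        (· ∈ (thetaIndex (pilotDataOfK T.D T.K)).Vbad) Frd IsoF Ob realify Strip IsoS Mv)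
      (split : SplittingMonoids Mv) {ObΔ : Type} {N : ∀ v : (thetaIndex (pilotDataOfK T.D T.K)).V, v ∈ (thetaIndex (pilotDataOfK T.D T.K)).Vbad → Type}
      [∀ v h, Monoid (N v h)] (qData : QPilotData ObΔ N)
      (j₀ : (thetaIndex (pilotDataOfK T.D T.K)).VQ → ℕ) (_ : ∀ vQ, j₀ vQ ≤ (pilotDataOfK T.D T.K).lstar)
      (σ : Set (Fin (thetaIndex (pilotDataOfK T.D T.K)).lstar × (thetaIndex (pilotDataOfK T.D T.K)).VQ))
      (_ : ∀ (i : Fin (thetaIndex (pilotDataOfK T.D T.K)).lstar) (vQ : (thetaIndex (pilotDataOfK T.D T.K)).VQ), (i, vQ) ∈ σ ↔ (i : ℕ) + 1 ≤ j₀ vQ),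
      onTrivialMass (settingPrVolSharp (pilotDataOfK T.D T.K) (logvAnalytic_analyticLogv (F := T.K)) M archPk archSub Ψ act Mmod region n lat
            sig split qData (exists_realising_qIdeles_pilotDataOfK T.D).choose (exists_realising_thetaIdeles_pilotDataOfK T.D).choose
            (exists_realising_qIdeles_pilotDataOfK T.D).choose_spec.1 (exists_realising_qIdeles_pilotDataOfK T.D).choose_spec.2.1) σ = T.gap ↔
        ∀ vQ : (thetaIndex (pilotDataOfK T.D T.K)).VQ, Sum.elim (fun _ : Unit => (0 : ℝ))
          (fun pp : Nat.Primes => (∑ v ∈ placesOver T.K pp, (pilotDataOfK T.D T.K).qPilot v * logNorm T.K v) / Module.finrank ℚ T.K) vQ ≠ 0 →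
          j₀ vQ = (pilotDataOfK T.D T.K).lstar := by
  intro M _ _ archPk archSub Ψ act Mmod region n HT LogLink IsFull lat Frd IsoF Ob realify Strip IsoS Mv _ sig split ObΔ N _ qData j₀ hj σ hσ
  letI := T.instFieldF; letI := T.instNumberFieldF; letI := T.instAlgebraF; letI := T.instFieldK; letI := T.instNumberFieldK
  letI := T.instAlgebraK; letI := T.instFieldFbar; letI := T.instAlgebraFbar; letI := T.instAlgebraKFbar; letI := T.instIsElliptic
  rw [← totalTrivialMass_chosen_eq_gap T M archPk archSub Ψ act Mmod region n lat sig split qData]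
  exact onTrivialMass_eq_totalTrivialMass_iff_forall_top_settingPrVolSharp (pilotDataOfK T.D T.K) (logvAnalytic_analyticLogv (F := T.K))
    M archPk archSub Ψ act Mmod region n lat sig split qData (exists_realising_qIdeles_pilotDataOfK T.D).choose
    (exists_realising_thetaIdeles_pilotDataOfK T.D).choose (exists_realising_qIdeles_pilotDataOfK T.D).choose_spec.1
    (exists_realising_qIdeles_pilotDataOfK T.D).choose_spec.2.1 (exists_realising_thetaIdeles_pilotDataOfK T.D).choose_spec.1
    (exists_realising_thetaIdeles_pilotDataOfK T.D).choose_spec.2.2 (exists_realising_qIdeles_pilotDataOfK T.D).choose_spec.2.2 hj σ hσ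

/-- **THE NO-LOSS [MU-C] FORCES FULL LICENCE OFF THE SLIVER**: at the datum, for a label-segment stratum `σ` (`j₀ ≤ l⋇`) and ANY `A`, rh2-T-1's `μ₀ = 1` regression of
[MU-C], `OffSigmaTolerance (1 − 1) A T (B_triv(σᶜ))` (⟺ `B_triv(σᶜ) ≤ A`, = [THR] of the record endpoint), forces `j₀(v_ℚ) = l⋇` at EVERY packet with
`(l⋇² − 1)·h(v_ℚ) > l⋇·A` — with `A = Tol(P,l) = ((l+1)/4)·5·d*·l`: every packet of place weight above `≈ 2·Tol/l` is licensed up to the top label, i.e. the datum is in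
the round-1 KEEP slice there (`l ≥ l₀(datum)`, Q3) — «Q1′ = Q3 up to the sliver», kernel form. [claim: Mochizuki2012, status: disputed] -/
theorem forall_top_of_offSigmaTolerance_one_chosen {P : NFPoint} {l : ℕ} (T : Cor22.ThetaVolumeDatumAt P l) :
    letI := T.instFieldF; letI := T.instNumberFieldF; letI := T.instAlgebraF; letI := T.instFieldK; letI := T.instNumberFieldK; letI := T.instAlgebraK;
        letI := T.instFieldFbar; letI := T.instAlgebraFbar; letI := T.instAlgebraKFbar; letI := T.instIsElliptic;
    ∀ (M : Type) [Field M] [NumberField M]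
      (archPk : ∀ (j : (thetaIndex (pilotDataOfK T.D T.K)).Label) (vQ : (thetaIndex (pilotDataOfK T.D T.K)).VQ), Set ((logShellsDH (pilotDataOfK T.D T.K) (analyticLogv T.K)).Packet j vQ))
      (archSub : ∀ (j : (thetaIndex (pilotDataOfK T.D T.K)).Label) (v : (thetaIndex (pilotDataOfK T.D T.K)).V),
        Set ((logShellsDH (pilotDataOfK T.D T.K) (analyticLogv T.K)).Packet j ((thetaIndex (pilotDataOfK T.D T.K)).over v)))
      (Ψ : ℤ → ∀ v : (thetaIndex (pilotDataOfK T.D T.K)).V, v ∈ (thetaIndex (pilotDataOfK T.D T.K)).Vbad → Set ((logShellsDH (pilotDataOfK T.D T.K) (analyticLogv T.K)).StarPacket v))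
      (act : ℤ → ∀ v : (thetaIndex (pilotDataOfK T.D T.K)).V, v ∈ (thetaIndex (pilotDataOfK T.D T.K)).Vbad →
        (logShellsDH (pilotDataOfK T.D T.K) (analyticLogv T.K)).StarPacket v → Module.End ℚ ((logShellsDH (pilotDataOfK T.D T.K) (analyticLogv T.K)).StarPacket v))
      (Mmod : ℤ → ∀ j : (thetaIndex (pilotDataOfK T.D T.K)).LabelStar, Set ((logShellsDH (pilotDataOfK T.D T.K) (analyticLogv T.K)).GlobalPacket j.1))
      (region : ℤ → ∀ j : (thetaIndex (pilotDataOfK T.D T.K)).LabelStar, FinDivisor M →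
        ∀ vQ : (thetaIndex (pilotDataOfK T.D T.K)).VQ, Set ((logShellsDH (pilotDataOfK T.D T.K) (analyticLogv T.K)).Packet j.1 vQ))
      (n : ℤ) {HT : Type} {LogLink : HT → HT → Type} {IsFull : ∀ {s t : HT}, LogLink s t → Prop} (lat : LGPGaussianLogThetaLattice LogLink IsFull)
      {Frd : Type} {IsoF : Frd → Frd → Type} {Ob : Frd → Type} {realify : Frd → Frd} {Strip : Type} {IsoS : Strip → Strip → Type}
      {Mv : ∀ v : (thetaIndex (pilotDataOfK T.D T.K)).V, v ∈ (thetaIndex (pilotDataOfK T.D T.K)).Vbad → Type} [∀ v h, Monoid (Mv v h)]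
      (sig : GlobalLGPFrobenioidSignature (thetaIndex (pilotDataOfK T.D T.K)).lstar (thetaIndex (pilotDataOfK T.D T.K)).V
        (· ∈ (thetaIndex (pilotDataOfK T.D T.K)).Vbad) Frd IsoF Ob realify Strip IsoS Mv)
      (split : SplittingMonoids Mv) {ObΔ : Type} {N : ∀ v : (thetaIndex (pilotDataOfK T.D T.K)).V, v ∈ (thetaIndex (pilotDataOfK T.D T.K)).Vbad → Type}
      [∀ v h, Monoid (N v h)] (qData : QPilotData ObΔ N)
      (j₀ : (thetaIndex (pilotDataOfK T.D T.K)).VQ → ℕ) (_ : ∀ vQ, j₀ vQ ≤ (pilotDataOfK T.D T.K).lstar)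
      (σ : Set (Fin (thetaIndex (pilotDataOfK T.D T.K)).lstar × (thetaIndex (pilotDataOfK T.D T.K)).VQ))
      (_ : ∀ (i : Fin (thetaIndex (pilotDataOfK T.D T.K)).lstar) (vQ : (thetaIndex (pilotDataOfK T.D T.K)).VQ), (i, vQ) ∈ σ ↔ (i : ℕ) + 1 ≤ j₀ vQ)
      (A : ℝ), OffSigmaTolerance (1 - 1) A T (offTrivialMass (settingPrVolSharp (pilotDataOfK T.D T.K) (logvAnalytic_analyticLogv (F := T.K)) M archPk archSub Ψ act Mmod region n lat
            sig split qData (exists_realising_qIdeles_pilotDataOfK T.D).choose (exists_realising_thetaIdeles_pilotDataOfK T.D).choose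
            (exists_realising_qIdeles_pilotDataOfK T.D).choose_spec.1 (exists_realising_qIdeles_pilotDataOfK T.D).choose_spec.2.1) σ) →
        ∀ vQ : (thetaIndex (pilotDataOfK T.D T.K)).VQ,
          ((pilotDataOfK T.D T.K).lstar : ℝ) * A <
            ((((pilotDataOfK T.D T.K).lstar : ℝ)) ^ 2 - 1) * Sum.elim (fun _ : Unit => (0 : ℝ))
              (fun pp : Nat.Primes => (∑ v ∈ placesOver T.K pp, (pilotDataOfK T.D T.K).qPilot v * logNorm T.K v) / Module.finrank ℚ T.K) vQ →
          j₀ vQ = (pilotDataOfK T.D T.K).lstar := by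
  intro M _ _ archPk archSub Ψ act Mmod region n HT LogLink IsFull lat Frd IsoF Ob realify Strip IsoS Mv _ sig split ObΔ N _ qData j₀ hj σ hσ A hMU vQ hheavy
  letI := T.instFieldF; letI := T.instNumberFieldF; letI := T.instAlgebraF; letI := T.instFieldK; letI := T.instNumberFieldK
  letI := T.instAlgebraK; letI := T.instFieldFbar; letI := T.instAlgebraFbar; letI := T.instAlgebraKFbar; letI := T.instIsElliptic
  have htol : offTrivialMass (settingPrVolSharp (pilotDataOfK T.D T.K) (logvAnalytic_analyticLogv (F := T.K)) M archPk archSub Ψ act Mmod region n lat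
            sig split qData (exists_realising_qIdeles_pilotDataOfK T.D).choose (exists_realising_thetaIdeles_pilotDataOfK T.D).choose
            (exists_realising_qIdeles_pilotDataOfK T.D).choose_spec.1 (exists_realising_qIdeles_pilotDataOfK T.D).choose_spec.2.1) σ ≤ A := by
    unfold OffSigmaTolerance at hMU
    linarith
  exact forall_top_of_offTrivialMass_le_settingPrVolSharp_labelSegment (pilotDataOfK T.D T.K) (logvAnalytic_analyticLogv (F := T.K))
    M archPk archSub Ψ act Mmod region n lat sig split qData (exists_realising_qIdeles_pilotDataOfK T.D).choose
    (exists_realising_thetaIdeles_pilotDataOfK T.D).choose (exists_realising_qIdeles_pilotDataOfK T.D).choose_spec.1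
    (exists_realising_qIdeles_pilotDataOfK T.D).choose_spec.2.1 (exists_realising_thetaIdeles_pilotDataOfK T.D).choose_spec.1
    (exists_realising_thetaIdeles_pilotDataOfK T.D).choose_spec.2.1 (exists_realising_thetaIdeles_pilotDataOfK T.D).choose_spec.2.2
    (exists_realising_qIdeles_pilotDataOfK T.D).choose_spec.2.2 hj σ hσ htol vQ hheavy

end Datum

end Summit.ABC.IUTFork.Repair.RH.CellWeights

end
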